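import Summits.Ventures.DiscreteObjects.Hadamard.Order6Final

/-!
# H(668): the order-6 analysis in one statement (packaging for STATEMENT.md)

Framing: lottery ticket; floor = certified bounds/negative ranges.

Cell pub-namedobj (venture DiscreteObjects), target (H), hadamard gen 14.  One quotable kernel statement combining
`hadamard668_aut_order6_even_six_cycles` (Order6Final) and `hadamard668_aut_order6_cube_fpf` (Order6Nega): for every Hadamard
matrix of order `668` and every signed automorphism `g = (π, κ, d, e)` with `π⁶ = κ⁶ = 1` (pointwise):
(1) the number of rows on `6`-cycles of `π` and the number of columns on `6`-cycles of `κ` are divisible by `12` (even numbers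
of `6`-cycles); (2) if moreover `π³` and `κ³` are fixed-point-free, then `#Fix(π²) ≡ #Fix(κ²) ≡ 8 (mod 12)`.
No order is excluded by this; structure theorem about a hypothetical H(668).  Ours; no `sorry`.
-/

namespace Summit.Ventures.DiscreteObjects.Hadamard

open Finset BigOperators Matrix

open Literature.Combinatorics.Designs.GoethalsSeidel (IsHadamardMatrix)

variable {ι : Type*} [Fintype ι] [DecidableEq ι]

/-- **H(668), order 6 — summary.**  For a signed automorphism `(π, κ, d, e)` of a Hadamard matrix of order `668` with
`π⁶ = κ⁶ = 1`: (1) `12 ∣ #{i | π² i ≠ i ∧ π³ i ≠ i}` and `12 ∣ #{j | κ² j ≠ j ∧ κ³ j ≠ j}` (even numbers of `6`-cycles);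
(2) if `π³`, `κ³` are fixed-point-free then `#{i | π² i = i} ≡ 8 (mod 12)` and `#{j | κ² j = j} ≡ 8 (mod 12)`. -/
theorem hadamard668_order6_summary {H : Matrix ι ι ℤ} (hH : IsHadamardMatrix H) (hι : Fintype.card ι = 668)
    {π κ : Equiv.Perm ι} {d e : ι → ℤ} (haut : IsSignedAut H π κ d e)
    (hπ6 : ∀ i, π (π (π (π (π (π i))))) = i) (hκ6 : ∀ j, κ (κ (κ (κ (κ (κ j))))) = j) :
    (12 ∣ (univ.filter (fun i => π (π i) ≠ i ∧ π (π (π i)) ≠ i)).card ∧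
      12 ∣ (univ.filter (fun j => κ (κ j) ≠ j ∧ κ (κ (κ j)) ≠ j)).card) ∧
    ((∀ i, π (π (π i)) ≠ i) → (∀ j, κ (κ (κ j)) ≠ j) →
      (univ.filter (fun i => π (π i) = i)).card % 12 = 8 ∧ (univ.filter (fun j => κ (κ j) = j)).card % 12 = 8) := by
  refine ⟨hadamard668_aut_order6_even_six_cycles hH hι haut hπ6 hκ6, fun hπ3 hκ3 => ?_⟩
  obtain ⟨-, -, h1, h2⟩ := hadamard668_aut_order6_cube_fpf hH hι haut hπ6 hκ6 hπ3 hκ3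
  exact ⟨h1, h2⟩

end Summit.Ventures.DiscreteObjects.Hadamard
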